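import Summits.BirchSwinnertonDyer.Rank1Residual.X11b.Three.CornerShapeGamma
import Summits.BirchSwinnertonDyer.Rank1Residual.X11b.Three.CornerShapeII
import Summits.BirchSwinnertonDyer.Rank1Residual.Additive.QuadraticTwistSurj
import Summits.BirchSwinnertonDyer.Rank1Residual.AdditivePotMult.Twist
import Literature.NumberTheory.DiophantineGeometry.TateAlgorithmTameTypesOddProofs
import Literature.NumberTheory.EllipticCurves.QuadraticTwistTateFormProofs
import Literature.NumberTheory.EllipticCurves.GlobalMinimalModelProofs
import Literature.NumberTheory.EllipticCurves.SzpiroLocalDataProofs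
import HarnessLib

/-!
# Class X11b at `p = 3`, the non-surjective CORNER: a potentially multiplicative place `v ∤ 2`
# has Kodaira type `Iₙ*` with `3 ∣ n` (team N8/O2 = cell `b2b-bsdres`, sub-target S14♭, seat x11b3-p6)

HONEST FRAMING (verbatim, cell `b2b-bsdres`, run/shared/lean/b2b/bsd-rank1-residual/): the goal of
the cell is to DELETE the COMBINATION-SHAPED residual classes of the Birch–Swinnerton-Dyer formula for
ALL analytic-rank `≤ 1` elliptic curves over `ℚ` — assembled STRICTLY from published theorems — so
that the rank-`≤ 1` remainder becomes exactly the CONSTRUCTION-SHAPED classes, which are TYPED, NOT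
attempted. This is not "finishing BSD". Team N8/O2 (X11b at `3`: `3 ∥ N`, `r_an = 1`, `E[3]`
irreducible; §I O2 OPEN, X11 ∧ r = 1 ∧ p = 3 CONSTRUCTION-SHAPED). Research route; nothing booked; NO
label changes. THEOREMS ONLY: no definition, no named fact, no `sorry`; UNCONDITIONAL (no Serre
hypothesis — unlike S14/S14♯, the potentially multiplicative places need only the Tate curve, which
the tree PROVES).

## What this file proves

The anatomy of the non-surjective corner (`Irr W 3 ∧ ¬ Surj W 3`, in particular
`ClassX11b W 3 ∧ ¬ Surj W 3`) at its POTENTIALLY MULTIPLICATIVE additive places: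

* `WeierstrassCurve.valuation_j_eq_exp_of_kodairaSymbolAt_eq_Istar_succ` — at a place `v ∤ 2` of
  Kodaira type `Iₙ₊₁*` one has `ord_v(j) = -(n+1)` EXACTLY (`v.valuation K W.j = exp (n+1)`; any
  Dedekind domain, perfect residue field; the tree's `one_lt_valuation_j_of_kodairaSymbolAt_eq_Istar_succ`
  records only `ord_v(j) < 0` — the proof is the same: `ord c₄ = 2`, `ord Δ = n + 7` on the local
  minimal model, Silverman *ATAEC* IV.9.4 Step 7, Table 4.1).
* `padicValInt_minimalDiscriminantInt_eq_of_mult_of_valuation_j` — for a globally minimal `W'/ℚ`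
  multiplicative at the place `v ∣ ℓ`, `v_ℓ(Δ_min(W')) = -ord_v(j(W'))` (Silverman *AEC* VII.5.1(b)).
* **`dvd_of_irr_of_not_surj_of_kodairaSymbolAt_Istar`** — for ANY prime `p` and an elliptic `W/ℚ`
  with `E[p]` irreducible but `ρ̄_{E,p}` NOT onto: at every place `v ∤ 2p` of Kodaira type `Iₙ*`,
  **`p ∣ n`**. Proof: if `n ≥ 1`, `ord_v(j) = -n < 0`, so a quadratic twist `E^{(d)}` is
  MULTIPLICATIVE at `v` (`exists_hasMultiplicativeReductionAt_quadraticTwist_of_one_lt_valuation_j`,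
  *ATAEC* V.5.3); on a global minimal model `W'` of `E^{(d)}` (`hasGlobalMinimalModel_rat`),
  `v_ℓ(Δ_min(W')) = -ord_v(j) = n`; if `p ∤ n` this is the hypothesis `Ram W' p`, and `E^{(d)}[p]`
  is irreducible with `E[p]` (`irr_iff_of_model_twist`), so `ρ̄_{E^{(d)},p}` is onto
  (`surj_of_irr_of_ram`: the Tate curve supplies a transvection, Serre 1972 Prop. 15) and so is
  `ρ̄_{E,p}` (`surj_iff_of_model_twist`) — contradiction.
* `Three.three_dvd_of_not_surj_of_kodairaSymbolAt_Istar` — the corner of X11b@3: at a place `v ∤ 2`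
  of type `Iₙ*`, `3 ∣ n` (the place over `3` is multiplicative, so `v ∤ 3` is automatic).
  Kernel form of `cells/x11b3/CORNER-CENSUS.md` §2.3′ (EVIDENCE there: over the 484 additive primes
  of the 296 corner class-pairs the 44 `Iₙ*` places at odd `ℓ` are `I₀*` ×25, `I₃*` ×15, `I₆*` ×4 —
  no other `n`; the hypothesis `v ∤ 2` is NOT idle: at `ℓ = 2` the corner shows `I₂*`, `I₄*`, `I₅*`,
  `I₇*`, `I₁₀*`, … e.g. `65712u1` has type `I₄*` at `2`). Together
  with S14 (`CornerShapeGamma[Serre]`: no `IV`/`IV*` away from `2`) and S14♯ (`CornerShapeII`: no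
  `II`/`II*` away from `2`) this completes the additive anatomy of the corner at odd places:
  `III`, `III*`, or `Iₙ*` with `3 ∣ n`.

HONEST VALUE: anatomy only — no TRUE-OPEN cell is closed, nothing is booked, no mark moves. Axioms:
`propext`, `Classical.choice`, `Quot.sound`.

## References

* [SilvermanATAEC1994] J. H. Silverman, *Advanced Topics in the Arithmetic of Elliptic Curves*,
  GTM 151: IV.9.4 Step 7 and Table 4.1 (PDF pp. 345, 365); V.5 Thm. 5.3 (twists of Tate curves);
  V.4–V.5 and Exercise 5.13(b) (inertia on the Tate curve).
* [SilvermanAEC2009] J. H. Silverman, *The Arithmetic of Elliptic Curves*, 2nd ed.: VII.5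
  Prop. 5.1(b); VIII.8 Cor. 8.3; X.5 Cor. 5.4.1.
* [Serre1972] J.-P. Serre, Invent. Math. 15 (1972), §1.12 and §2.4 Prop. 15.
* Cell files: `cells/x11b3/CORNER-CENSUS.md` §2.3′, `OWNERS.md` (S14, S14♯, S14♭).
-/

noncomputable section

open scoped Classical NumberField

open WeierstrassCurve NumberField IsDedekindDomain Literature.NumberTheory.EllipticCurves
  Rat.HeightOneSpectrum
  Literature.NumberTheory.DiophantineGeometry
  Literature.NumberTheory.DiophantineGeometry.TateAlgorithm
  Literature.NumberTheory.EllipticCurves.Rank1Residual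
open IsDiscreteValuationRing hiding maximalIdeal

/-! ### Kodaira `Iₙ₊₁*` at `v ∤ 2`: `ord_v(j) = -(n+1)` exactly (any Dedekind domain) -/

namespace WeierstrassCurve

section Local

variable {A : Type*} [CommRing A] [IsDedekindDomain A] {K : Type*} [Field K]
  [Algebra A K] [IsFractionRing A K] (v : HeightOneSpectrum A) (W : WeierstrassCurve K)

/-- **Type `Iₙ₊₁*` at a place `v ∤ 2` has `ord_v(j) = -(n+1)`** (`v.valuation K W.j = exp (n+1)`):
on the integral local minimal model `M` over `O_v`, `ord c₄(M) = 2` and `ord Δ(M) = n + 7`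
(`addVal_Δ_toNat_eq_of_kodairaSymbolOfMinimal_eq_Istar_succ`), and `j · Δ(M) = c₄(M)³` with `j = j(E)`
a `K_v`-isomorphism invariant. The tree's `one_lt_valuation_j_of_kodairaSymbolAt_eq_Istar_succ` keeps
only `ord_v(j) < 0`; the proof is the same (adapted verbatim up to its last step).
[cite: SilvermanATAEC1994, IV.9.4 Step 7 and Table 4.1] -/
theorem valuation_j_eq_exp_of_kodairaSymbolAt_eq_Istar_succ [W.IsElliptic]
    [PerfectField (IsLocalRing.ResidueField (v.adicCompletionIntegers K))]
    (h2 : ringChar (A ⧸ v.asIdeal) ≠ 2) {n : ℕ} (hT : W.kodairaSymbolAt v = .Istar (n + 1)) :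
    v.valuation K W.j = WithZero.exp ((n : ℤ) + 1) := by
  have hu2 := HeightOneSpectrum.isUnit_two_adicCompletionIntegers K v h2
  rw [kodairaSymbolAt_def] at hT
  set O := v.adicCompletionIntegers K with hO
  set M := W.localMinimalIntegralModel v with hM
  have hΔ0 : M.Δ ≠ 0 := localMinimalIntegralModel_Δ_ne_zero v W
  obtain ⟨hord, u, hu, hc₄⟩ :=
    addVal_Δ_toNat_eq_of_kodairaSymbolOfMinimal_eq_Istar_succ hu2 M hΔ0 hT
  -- valuations on `K_v` of `Δ(M)` and `c₄(M)`
  obtain ⟨N, hN, hvΔ⟩ := HeightOneSpectrum.exists_addVal_adicCompletionIntegers_eq K v M.Δ hΔ0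
  have hNn : N = n + 7 := by
    have := congrArg ENat.toNat hN
    rw [hord] at this
    simpa using this.symm
  rw [hNn] at hvΔ
  have hϖ : Irreducible (uniformizer O) := irreducible_uniformizer
  obtain ⟨Nπ, hNπ, hvπ⟩ :=
    HeightOneSpectrum.exists_addVal_adicCompletionIntegers_eq K v (uniformizer O) hϖ.ne_zero
  have hNπ1 : Nπ = 1 := by
    have h1 : addVal O (uniformizer O) = 1 := addVal_uniformizer hϖ
    rw [h1] at hNπ
    exact_mod_cast hNπ.symm
  rw [hNπ1] at hvπ
  have hvu : Valued.v ((u : O) : v.adicCompletion K) = 1 :=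
    HeightOneSpectrum.adicCompletionIntegers.isUnit_iff_valued_eq_one.mp hu
  have hvc₄ : Valued.v ((M.c₄ : O) : v.adicCompletion K) = WithZero.exp (-2 : ℤ) := by
    rw [hc₄]
    push_cast
    rw [map_mul, map_pow, hvπ, hvu, mul_one, ← WithZero.exp_nsmul]
    norm_num
  -- `j · Δ(M) = c₄(M)³` in `K_v`
  have hjΔ : ∀ (E : WeierstrassCurve (v.adicCompletion K)) [E.IsElliptic],
      E.j * E.Δ = E.c₄ ^ 3 := fun E _ ↦ by
    rw [WeierstrassCurve.j, ← coe_Δ', mul_comm, ← mul_assoc, Units.mul_inv, one_mul]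
  haveI hXell : (W.baseChange (v.adicCompletion K)).IsElliptic := by
    unfold baseChange; infer_instance
  obtain ⟨C, hC⟩ : ∃ C : VariableChange (v.adicCompletion K),
      C • W.baseChange (v.adicCompletion K) = W.localMinimalModel v := ⟨_, rfl⟩
  have key : (W.j : v.adicCompletion K) * ((M.Δ : O) : v.adicCompletion K) =
      ((M.c₄ : O) : v.adicCompletion K) ^ 3 := by
    have hj' : (C • W.baseChange (v.adicCompletion K)).j = (W.j : v.adicCompletion K) := by
      rw [variableChange_j]; exact W.map_j _
    have hΔ' : ((M.Δ : O) : v.adicCompletion K) = (C • W.baseChange (v.adicCompletion K)).Δ := by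
      rw [hC, hM, localMinimalIntegralModel]
      exact integralModel_Δ_eq (v.adicCompletionIntegers K) (W.localMinimalModel v)
    have hc₄' : ((M.c₄ : O) : v.adicCompletion K) =
        (C • W.baseChange (v.adicCompletion K)).c₄ := by
      rw [hC, hM, localMinimalIntegralModel]
      exact integralModel_c₄_eq (v.adicCompletionIntegers K) (W.localMinimalModel v)
    rw [hΔ', hc₄', ← hj']
    exact hjΔ _
  -- read off `v(j) = exp (n + 1)`
  have hvj : Valued.v (W.j : v.adicCompletion K) = WithZero.exp ((n : ℤ) + 1) := by
    have h := congrArg Valued.v key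
    rw [map_mul, map_pow, hvΔ, hvc₄, ← WithZero.exp_nsmul] at h
    have hne : WithZero.exp (-((n + 7 : ℕ) : ℤ)) ≠ 0 := WithZero.exp_ne_zero
    rw [← eq_div_iff hne] at h
    rw [h, ← WithZero.exp_sub]
    congr 1
    push_cast
    ring
  rw [← HeightOneSpectrum.valuedAdicCompletion_eq_valuation', hvj]

/-- **Type `Iₙ*` is ADDITIVE: at such a place the reduction is not multiplicative** (Tate's
algorithm Step 2 returns `Iₘ` at a multiplicative place, `kodairaSymbolAt_eq_I_iff`).
[cite: SilvermanATAEC1994, IV.9.4 Step 2 (PDF p. 344)] -/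
theorem not_hasMultiplicativeReductionAt_of_kodairaSymbolAt_Istar [W.IsElliptic]
    [Finite (A ⧸ v.asIdeal)] {n : ℕ} (hk : W.kodairaSymbolAt v = .Istar n) :
    ¬ W.HasMultiplicativeReductionAt v := by
  haveI : Finite (IsLocalRing.ResidueField (v.adicCompletionIntegers K)) :=
    HeightOneSpectrum.finite_residueField_adicCompletionIntegers K v
  haveI : PerfectField (IsLocalRing.ResidueField (v.adicCompletionIntegers K)) :=
    PerfectField.ofFinite
  intro hm
  have hn : W.ordMinimalDiscriminant v ≠ 0 :=
    (Summit.BirchSwinnertonDyer.Rank1Residual.X11b.ordMinimalDiscriminant_pos_of_hasMultiplicativeReductionAt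
      v W hm).ne'
  have hI : W.kodairaSymbolAt v = .I (W.ordMinimalDiscriminant v) :=
    (WeierstrassCurve.kodairaSymbolAt_eq_I_iff_holds v W hn).mpr ⟨hm, rfl⟩
  rw [hk] at hI
  exact KodairaSymbol.noConfusion hI

end Local

/-! ### Over `ℚ`: `v_ℓ(Δ_min) = -ord_v(j)` at a multiplicative place of a global minimal model -/

/-- **`v_ℓ(Δ_min(W')) = -ord_v(j(W'))` for a globally minimal `W'/ℚ` multiplicative at the place
`v ∣ ℓ`**: a global minimal equation is minimal at `v` with `v(c₄) = 1`
(`hasMultiplicativeReductionAt_iff_of_isMinimalAt`), `j · Δ = c₄³`, and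
`v(Δ(W')) = exp(-v_ℓ(Δ_min))` (`valuation_Δ_eq_of_isMinimalAt`, `ordMinimalDiscriminant_eq_padicValInt`).
So `v.valuation ℚ W'.j = exp m` forces `v_ℓ(Δ_min(W')) = m`. [cite: SilvermanAEC2009, VII.5 Prop. 5.1(b)] -/
theorem padicValInt_minimalDiscriminantInt_eq_of_mult_of_valuation_j (W' : WeierstrassCurve ℚ)
    [W'.IsElliptic] [W'.IsGloballyMinimal] (v : HeightOneSpectrum (𝓞 ℚ)) {ℓ : ℕ} [Fact ℓ.Prime]
    (hv : (primesEquiv v : ℕ) = ℓ) (hmult : W'.HasMultiplicativeReductionAt v) {m : ℕ}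
    (hj : v.valuation ℚ W'.j = WithZero.exp (m : ℤ)) :
    padicValInt ℓ W'.minimalDiscriminantInt = m := by
  have hmin : W'.IsMinimalAt v := IsGloballyMinimal.isMinimalAt W' v
  obtain ⟨-, hc₄⟩ := (hasMultiplicativeReductionAt_iff_of_isMinimalAt hmin).mp hmult
  have hΔ : v.valuation ℚ W'.Δ = WithZero.exp (-(W'.ordMinimalDiscriminant v : ℤ)) :=
    valuation_Δ_eq_of_isMinimalAt_holds v W' hmin
  have hjΔ : W'.j * W'.Δ = W'.c₄ ^ 3 := by
    rw [WeierstrassCurve.j, ← coe_Δ', mul_comm, ← mul_assoc, Units.mul_inv, one_mul]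
  have h := congrArg (v.valuation ℚ) hjΔ
  rw [map_mul, map_pow, hj, hΔ, hc₄, one_pow, ← WithZero.exp_add, ← WithZero.exp_zero,
    WithZero.exp_inj] at h
  have hord : W'.ordMinimalDiscriminant v = m := by omega
  rw [← Summit.BirchSwinnertonDyer.Rank1Residual.X11b.ordMinimalDiscriminant_eq_padicValInt W' v hv]
  exact hord

end WeierstrassCurve

/-! ### `Irr ∧ ¬Surj` at `p` forces `p ∣ n` at every `Iₙ*` place `v ∤ 2p` -/

namespace Summit.BirchSwinnertonDyer.Rank1Residual.X11b

variable (W : WeierstrassCurve ℚ) [W.IsElliptic] (p : ℕ) [hp : Fact p.Prime]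

/-- **`E[p]` irreducible, `ρ̄_{E,p}` not onto ⟹ `p ∣ n` at every place `v ∤ 2p` of Kodaira type
`Iₙ*`** (any prime `p`; `W/ℚ` any elliptic Weierstrass equation). If `n ≥ 1` then `ord_v(j) = -n`
(`valuation_j_eq_exp_of_kodairaSymbolAt_eq_Istar_succ`), a quadratic twist `E^{(d)}` is
multiplicative at `v` (*ATAEC* V.5.3, `exists_hasMultiplicativeReductionAt_quadraticTwist_of_one_lt_valuation_j`),
and on a global minimal model `W'` of `E^{(d)}` one has `v_ℓ(Δ_min(W')) = n`; were `p ∤ n`, `W'`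
would satisfy `Ram W' p` with `Irr W' p` (`irr_iff_of_model_twist`), hence `Surj W' p`
(`surj_of_irr_of_ram`: inertia at `ℓ` on the Tate curve gives an element of order `p`, impossible
in a proper irreducible subgroup with full determinant, Serre 1972 Prop. 15), hence `Surj W p`
(`surj_iff_of_model_twist`) — contradiction. [cite: SilvermanATAEC1994, V.5 Thm. 5.3 and Exercise 5.13(b)]
[cite: Serre1972, §1.12 and §2.4 Prop. 15] -/
theorem dvd_of_irr_of_not_surj_of_kodairaSymbolAt_Istar (hirr : Irr W p) (hns : ¬ Surj W p)
    {v : HeightOneSpectrum (𝓞 ℚ)} (hv2 : (primesEquiv v : ℕ) ≠ 2) (hvp : (primesEquiv v : ℕ) ≠ p)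
    {n : ℕ} (hk : W.kodairaSymbolAt v = .Istar n) : p ∣ n := by
  rcases Nat.eq_zero_or_pos n with rfl | hn
  · exact dvd_zero p
  obtain ⟨m, rfl⟩ : ∃ m, n = m + 1 := ⟨n - 1, by omega⟩
  by_contra hndvd
  -- the residue characteristic of `v` is `ℓ ≠ 2`
  set ℓ : ℕ := (primesEquiv v : ℕ) with hℓdef
  haveI hℓ : Fact ℓ.Prime := ⟨(primesEquiv v).2⟩
  have hc := X2.ringChar_quot_asIdeal_eq_primesEquiv v
  have hc2 : ringChar (𝓞 ℚ ⧸ v.asIdeal) ≠ 2 := by rw [hc]; exact hv2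
  haveI : Finite (IsLocalRing.ResidueField (v.adicCompletionIntegers ℚ)) :=
    HeightOneSpectrum.finite_residueField_adicCompletionIntegers ℚ v
  haveI : PerfectField (IsLocalRing.ResidueField (v.adicCompletionIntegers ℚ)) :=
    PerfectField.ofFinite
  -- `ord_v(j) = -(m+1) < 0`
  have hj : v.valuation ℚ W.j = WithZero.exp ((m : ℤ) + 1) :=
    W.valuation_j_eq_exp_of_kodairaSymbolAt_eq_Istar_succ v hc2 hk
  have hj1 : 1 < v.valuation ℚ W.j := by
    rw [hj, ← WithZero.exp_zero, WithZero.exp_lt_exp]; omega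
  -- a quadratic twist is multiplicative at `v`; take a global minimal model `W'` of it
  obtain ⟨d, hd0, hmult⟩ :=
    W.exists_hasMultiplicativeReductionAt_quadraticTwist_of_one_lt_valuation_j v hj1
  haveI := W.isElliptic_quadraticTwist hd0
  obtain ⟨C, hC⟩ := hasGlobalMinimalModel_rat_holds (W.quadraticTwist d)
  set W' : WeierstrassCurve ℚ := C • W.quadraticTwist d with hW'
  haveI : W'.IsGloballyMinimal := hC
  have hWd : ∃ C' : VariableChange ℚ, C' • W.quadraticTwist d = W' := ⟨C, rfl⟩
  have hmult' : W'.HasMultiplicativeReductionAt v :=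
    (hasMultiplicativeReductionAt_smul_iff_holds v (W.quadraticTwist d) C).mpr hmult
  -- `j(W') = j(W)`, so `v_ℓ(Δ_min(W')) = m + 1`
  have hjW' : W'.j = W.j := by
    change (C • W.quadraticTwist d).j = W.j
    rw [variableChange_j, W.j_quadraticTwist hd0]
  have hj' : v.valuation ℚ W'.j = WithZero.exp ((m + 1 : ℕ) : ℤ) := by
    rw [hjW', hj]; push_cast; rfl
  have hord : padicValInt ℓ W'.minimalDiscriminantInt = m + 1 :=
    W'.padicValInt_minimalDiscriminantInt_eq_of_mult_of_valuation_j v rfl hmult' hj'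
  -- `Ram W' p`, `Irr W' p`, hence `Surj W' p` and `Surj W p`
  have hmultPrime : W'.HasMultiplicativeReductionAtPrime ℓ :=
    (W'.hasMultiplicativeReductionAtPrime_iff_hasMultiplicativeReductionAt_ringOfIntegers v).mpr hmult'
  have hram : Ram W' p := ⟨ℓ, hℓ, hvp, hmultPrime, by rw [hord]; exact hndvd⟩
  have hirr' : Irr W' p := (AdditivePotMult.irr_iff_of_model_twist (W := W) hd0 hWd).mpr hirr
  have hsurj' : Surj W' p := surj_of_irr_of_ram W' p hirr' hram
  exact hns ((Additive.surj_iff_of_model_twist W p hd0 hWd).mp hsurj')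

/-- Binder-list form: with `E[p]` irreducible and `ρ̄_{E,p}` not onto, a place `v ∤ 2p` of type
`Iₙ*` with `p ∤ n` does not exist. [cite: SilvermanATAEC1994, V.5 Thm. 5.3 and Exercise 5.13(b)] -/
theorem not_kodairaSymbolAt_Istar_of_irr_of_not_surj_of_not_dvd (hirr : Irr W p) (hns : ¬ Surj W p)
    {v : HeightOneSpectrum (𝓞 ℚ)} (hv2 : (primesEquiv v : ℕ) ≠ 2) (hvp : (primesEquiv v : ℕ) ≠ p)
    {n : ℕ} (hn : ¬ p ∣ n) : W.kodairaSymbolAt v ≠ .Istar n := fun hk ↦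
  hn (dvd_of_irr_of_not_surj_of_kodairaSymbolAt_Istar W p hirr hns hv2 hvp hk)

end Summit.BirchSwinnertonDyer.Rank1Residual.X11b

/-! ### The corner of X11b@3 -/

namespace Summit.BirchSwinnertonDyer.Rank1Residual.X11b.Three

variable (W : WeierstrassCurve ℚ) [W.IsElliptic]

/-- **A place of type `Iₙ*` of an X11b@3 pair lies over a prime `ℓ ≠ 3`**: the reduction at the
place over `3` is multiplicative (`3 ∥ N`), never additive. [folklore] -/
theorem primesEquiv_ne_three_of_kodairaSymbolAt_Istar [Fact (Nat.Prime 3)]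
    (hX : ClassX11b W 3) {v : HeightOneSpectrum (𝓞 ℚ)} {n : ℕ} (hk : W.kodairaSymbolAt v = .Istar n) :
    (primesEquiv v : ℕ) ≠ 3 := by
  intro h3
  have hmult3 : Mult W 3 := hX.2.2.1
  have key : ∀ (q : ℕ) (hq : Fact q.Prime), q = 3 →
      @WeierstrassCurve.HasMultiplicativeReductionAtPrime W q hq := by
    rintro q hq rfl; exact hmult3
  have hmult : W.HasMultiplicativeReductionAt v :=
    (W.hasMultiplicativeReductionAtPrime_iff_hasMultiplicativeReductionAt_ringOfIntegers v).mp
      (key _ _ h3)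
  exact W.not_hasMultiplicativeReductionAt_of_kodairaSymbolAt_Istar v hk hmult

/-- **S14♭: on the non-surjective corner of X11b@3, a place `v ∤ 2` of Kodaira type `Iₙ*` has
`3 ∣ n`** (`ClassX11b W 3`, `¬ Surj W 3`; UNCONDITIONAL). The kernel form of
`cells/x11b3/CORNER-CENSUS.md` §2.3′: at odd `ℓ` the `Iₙ*` corner places are `I₀*` ×25 / `I₃*` ×15 /
`I₆*` ×4 and nothing else (296 class-pairs, two engines); `v ∤ 2` is needed (`65712u1`: `I₄*` at `2`).
Nothing booked; no TRUE-OPEN cell touched.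
[cite: SilvermanATAEC1994, V.5 Thm. 5.3 and Exercise 5.13(b)] [cite: Serre1972, §1.12 and §2.4 Prop. 15] -/
theorem three_dvd_of_not_surj_of_kodairaSymbolAt_Istar [Fact (Nat.Prime 3)]
    (hX : ClassX11b W 3) (hns : ¬ Surj W 3) {v : HeightOneSpectrum (𝓞 ℚ)}
    (hv2 : (primesEquiv v : ℕ) ≠ 2) {n : ℕ} (hk : W.kodairaSymbolAt v = .Istar n) : 3 ∣ n :=
  dvd_of_irr_of_not_surj_of_kodairaSymbolAt_Istar W 3 hX.2.2.2 hns hv2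
    (primesEquiv_ne_three_of_kodairaSymbolAt_Istar W hX hk) hk

/-- **S14♭, binder-list form: on the corner there is NO place `v ∤ 2` of type `Iₙ*` with `3 ∤ n`.**
[cite: SilvermanATAEC1994, V.5 Thm. 5.3 and Exercise 5.13(b)] -/
theorem not_kodairaSymbolAt_Istar_of_not_surj_of_not_dvd [Fact (Nat.Prime 3)]
    (hX : ClassX11b W 3) (hns : ¬ Surj W 3) {v : HeightOneSpectrum (𝓞 ℚ)}
    (hv2 : (primesEquiv v : ℕ) ≠ 2) {n : ℕ} (hn : ¬ 3 ∣ n) : W.kodairaSymbolAt v ≠ .Istar n := fun hk ↦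
  hn (three_dvd_of_not_surj_of_kodairaSymbolAt_Istar W hX hns hv2 hk)


/-! ### Capstone (S14 ∧ S14♯ ∧ S14♭): the additive anatomy of the corner at odd places -/

/-- **THE ADDITIVE ANATOMY OF THE CORNER AT ODD PLACES (granted `hF`)**: on the non-surjective corner
of X11b@3, at an ADDITIVE place `v ∤ 2` the Kodaira type is `III`, `III*`, or `Iₙ*` WITH `3 ∣ n` —
S14 (`CornerShapeGamma`: no `IV`/`IV*` off `2`) ∧ S14♯ (`CornerShapeII`: no `II`/`II*` off `2`), both
granted Serre's inertia order `hF` at the potentially good places `v ∣ ℓ ≥ 5`, ∧ S14♭ (this file,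
unconditional). Kernel form of `cells/x11b3/CORNER-CENSUS.md` §2.3′ in full (odd `ℓ`: `III` / `III*` /
`I₀*` / `I₃*` / `I₆*`). CONDITIONAL on `hF` only; nothing booked; no TRUE-OPEN cell touched.
[cite: MartinWatkins2006, §3.2] [cite: Serre1972, §5.6 (p. 312) and §2.4 Prop. 15]
[cite: SilvermanATAEC1994, IV.9.4 Table 4.1; V.5 Thm. 5.3] -/
theorem kodairaSymbolAt_eq_III_or_IIIstar_or_Istar_dvd_of_not_surj [Fact (Nat.Prime 3)]
    (hF : ∀ v : HeightOneSpectrum (𝓞 ℚ), 5 ≤ (primesEquiv v : ℕ) → v.valuation ℚ W.j ≤ 1 →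
      12 / Nat.gcd 12 (W.ordMinimalDiscriminant v) ∣ Nat.card (galoisRepTorsion W (3 : ℕ)).range)
    (hX : ClassX11b W 3) (hns : ¬ Surj W 3) {v : HeightOneSpectrum (𝓞 ℚ)}
    (hv : (primesEquiv v : ℕ) ≠ 2) (hadd : W.HasAdditiveReductionAt v) :
    W.kodairaSymbolAt v = .III ∨ W.kodairaSymbolAt v = .IIIstar ∨
      ∃ n : ℕ, 3 ∣ n ∧ W.kodairaSymbolAt v = .Istar n := by
  rcases kodairaSymbolAt_eq_III_or_IIIstar_or_Istar_of_not_surj W hF hX hns hv hadd with h | h | ⟨n, hn⟩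
  · exact Or.inl h
  · exact Or.inr (Or.inl h)
  · exact Or.inr (Or.inr ⟨n, three_dvd_of_not_surj_of_kodairaSymbolAt_Istar W hX hns hv hn, hn⟩)

/-- **The additive anatomy of the corner at odd places, with the named fact** (CONDITIONAL on
`Serre1972.inertiaOrder_dvd_card_range_galoisRepTorsion` = Serre 1972 §5.6 via Martin–Watkins 2006):
`III`, `III*`, or `Iₙ*` with `3 ∣ n`. [cite: MartinWatkins2006, §3.2] [cite: Serre1972, §5.6 (p. 312)]
[cite: SilvermanATAEC1994, IV.9.4 Table 4.1; V.5 Thm. 5.3] -/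
theorem kodairaSymbolAt_eq_III_or_IIIstar_or_Istar_dvd_of_not_surj_of_serre [Fact (Nat.Prime 3)]
    (hS : Serre1972.inertiaOrder_dvd_card_range_galoisRepTorsion)
    (hX : ClassX11b W 3) (hns : ¬ Surj W 3) {v : HeightOneSpectrum (𝓞 ℚ)}
    (hv : (primesEquiv v : ℕ) ≠ 2) (hadd : W.HasAdditiveReductionAt v) :
    W.kodairaSymbolAt v = .III ∨ W.kodairaSymbolAt v = .IIIstar ∨
      ∃ n : ℕ, 3 ∣ n ∧ W.kodairaSymbolAt v = .Istar n :=
  kodairaSymbolAt_eq_III_or_IIIstar_or_Istar_dvd_of_not_surj W (serre_hF_three W hS) hX hns hv hadd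

end Summit.BirchSwinnertonDyer.Rank1Residual.X11b.Three
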